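import Summits.AtomisticToContinuum.HydrodynamicLimit.Theses.JParityClosure
import Literature.MathematicalPhysics.KineticTheory.HardSphereEulerLLN
import Literature.Analysis.FluidPDE.HardSphereAlexander

/-!
# `RateFloor` is false without `0 < η` (load-bearing analysis)

Negative knowledge for the crux `JParityClosure.RateFloor` (stmt-AtomisticToContinuum-13080), from the standing
disprover's `Cruxes/RateFloor/Disproof.lean` §3.  `RateFloorWithoutEtaPos` is the crux VERBATIM with the hypothesis
`0 < η` deleted, and it is FALSE for a bookkeeping reason that every prover should keep in mind: the collision
functional `K_N[χΞ]` and the pair functional `∫χB^Ξ` BOTH vanish for `χ = Ξ = 0`, so the deviation event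
`{K_N < g₀σ³∫χB − η}` is `{0 < −η}` — everything once `η < 0` — and has local-Gibbs probability `1 > δ`.
The flow family is inhabited by Alexander's theorem (`HardSphereFlow.nonempty_torus_holds`) and the local Gibbs
laws have mass one for `σ ≤ 1/2` (`isProbabilityMeasure_localGibbsLaw`).  Dual reading (Disproof §2): WITH `0 < η`
the event is EMPTY whenever `g₀σ³∫χB^Ξ ≤ η`, so no small-weight mark (velocity tails, near-grazing impact, short
windows) can ever witness a violation — the content of the crux sits entirely in `O(1)`-weight classes of pairs.
refuter-cdisprove-stmt-AtomisticToContinuum-13080-0.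
-/

noncomputable section

namespace Summit.AtomisticToContinuum.HydrodynamicLimit.Theorems

open MeasureTheory Filter Set Topology
open scoped ENNReal
open Literature.MathematicalPhysics.KineticTheory Literature.Analysis.FluidPDE

/-- The crux `RateFloor` with the hypothesis `0 < η` deleted (all else verbatim). -/
def RateFloorWithoutEtaPos : Prop :=
  ∃ g₀ : ℝ, 0 < g₀ ∧ ∀ (a₀ θ₀ : Literature.MathematicalPhysics.KineticTheory.T3 → ℝ) (u₀ : Literature.MathematicalPhysics.KineticTheory.T3 → Literature.MathematicalPhysics.KineticTheory.V3), Continuous a₀ → Continuous θ₀ → Continuous u₀ → (∀ x, 0 < a₀ x) → (∀ x, 0 < θ₀ x) → ∃ σ₀ : ℝ, 0 < σ₀ ∧ ∀ σ : ℝ, 0 < σ → σ < σ₀ → ∀ Φ : (N : ℕ) → Literature.Analysis.FluidPDE.HardSphereFlow (Literature.Analysis.FluidPDE.Torus.geometry (Fin 3)) (Literature.MathematicalPhysics.KineticTheory.hsDiameter σ N) (N + 1), ∀ τ : ℝ, 0 < τ → ∀ χ : ℝ × UnitAddTorus (Fin 3) → ℝ, Continuous χ → (∀ p, 0 ≤ χ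 p) → ∀ Ξ : EuclideanSpace ℝ (Fin 3) × EuclideanSpace ℝ (Fin 3) × EuclideanSpace ℝ (Fin 3) → ℝ, Continuous Ξ → (∀ q, 0 ≤ Ξ q) → (∃ C : ℝ, ∀ q, Ξ q ≤ C) → ∀ η δ : ℝ, 0 < δ → ∃ r₀ : ℝ, 0 < r₀ ∧ ∀ r : ℝ, 0 < r → r < r₀ → ∃ N₀ : ℕ, ∀ N : ℕ, N₀ ≤ N → let ε := Literature.MathematicalPhysics.KineticTheory.hsDiameter σ N; let G := Literature.Analysis.FluidPDE.Torus.geometry (Fin 3); let γ := fun z (s : ℝ) => (Φ N).flow s z; let bx : UnitAddTorus (Fin 3) → UnitAddTorus (Fin 3) → ℝ := fun x y => 3 / (Real.pi * r ^ 3) * max (1 - Literature.Analysis.FluidPDE.Torus.euclidDist x y / r) 0; let Θ := fun (Ξ : EuclideanSpace ℝ (Fin 3) × EuclideanSpace ℝ (Fin 3) × EuclideanSpace ℝ (Fin 3) → ℝ) (v w : EuclideanSpace ℝ (Fin 3)) => ∫ ω : Metric.sphere (0 : EuclideanSpace ℝ (Fin 3)) 1, Ξ ((ω : EuclideanSpace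 ℝ (Fin 3)), v, w) * Literature.MathematicalPhysics.KineticTheory.hardSphereKernel (w, v) ω ∂Literature.MathematicalPhysics.KineticTheory.sphereMeasure; let B := fun Ξ z s (x₀ : UnitAddTorus (Fin 3)) => ∫ p, bx p.1.1 x₀ * bx p.2.1 x₀ * Θ Ξ p.1.2 p.2.2 ∂((Literature.Analysis.FluidPDE.empiricalMeasure (γ z s)).prod (Literature.Analysis.FluidPDE.empiricalMeasure (γ z s))); let pv := fun z s (i j : Fin (N + 1)) => Literature.Analysis.FluidPDE.reflectVel (G.sepVec (γ z s i).1 (γ z s j).1) ((γ z s i).2, (γ z s j).2); let Kc := fun (Fn : Literature.Analysis.FluidPDE.Config (N + 1) (Fin 3) Literature.MathematicalPhysics.KineticTheory.T3 → ℝ → Fin (N + 1) → Fin (N + 1) → ℝ) z => ε / (N + 1 : ℝ) * ∑ᶠ (s : ℝ) (_ : s ∈ Literature.Analysis.FluidPDE.collisionTimes G ε (γ z) ∩ Set.Icc 0 τ), ∑ i : Fin (N + 1), ∑ j : Fin (N + 1), (if i ≠ j ∧ ‖G.sepVec (γ z s i).1 (γ z s j).1‖ = ε then Fn z s i j else 0);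 Literature.MathematicalPhysics.KineticTheory.localGibbsLaw σ a₀ u₀ θ₀ N (Φ N) {z | Kc (fun z s i j => χ (s, (γ z s i).1) * Ξ (ε⁻¹ • G.sepVec (γ z s i).1 (γ z s j).1, (pv z s i j).1, (pv z s i j).2)) z < g₀ * σ ^ 3 * (∫ s in Set.Icc (0 : ℝ) τ, ∫ x : UnitAddTorus (Fin 3), χ (s, x) * B Ξ z s x) - η} ≤ ENNReal.ofReal δ

namespace RateFloorWithoutEtaPos

/-- `0 < η` is load-bearing in `RateFloor`: without it, `η = -1`, `χ = 0`, `Ξ = 0` make the deviation event the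
whole space (probability `1 > 1/2 = δ`) — profiles `(1, 1, 0)`, `σ = min (σ₀/2) (1/4)`, Alexander's flows.
[folklore] -/
theorem rateFloor_false_without_etaPos : ¬ RateFloorWithoutEtaPos := by
  rintro ⟨g₀, -, h⟩
  obtain ⟨σ₀, hσ₀, h⟩ := h (fun _ => 1) (fun _ => 1) (fun _ => 0) continuous_const continuous_const
    continuous_const (fun _ => one_pos) (fun _ => one_pos)
  set σ : ℝ := min (σ₀ / 2) (1 / 4) with hσdef
  have hσpos : 0 < σ := lt_min (by linarith) (by norm_num)
  have hσlt : σ < σ₀ := (min_le_left _ _).trans_lt (by linarith)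
  have hσhalf : σ ≤ 1 / 2 := (min_le_right _ _).trans (by norm_num)
  have hσlt2 : σ < 2⁻¹ := (min_le_right _ _).trans_lt (by norm_num)
  have hΦ : ∀ N : ℕ, Nonempty (HardSphereFlow (Torus.geometry (Fin 3)) (hsDiameter σ N) (N + 1)) :=
    fun N => HardSphereFlow.nonempty_torus_holds (hsDiameter_pos hσpos N)
      ((hsDiameter_le hσpos.le N).trans_lt hσlt2) (N + 1)
  obtain ⟨r₀, hr₀, h⟩ := h σ hσpos hσlt (fun N => (hΦ N).some) 1 one_pos (fun _ => 0) continuous_const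
    (fun _ => le_rfl) (fun _ => 0) continuous_const (fun _ => le_rfl) ⟨0, fun _ => le_rfl⟩ (-1) (1 / 2)
    (by norm_num)
  obtain ⟨N₀, h⟩ := h (r₀ / 2) (by linarith) (by linarith)
  have h := h N₀ le_rfl
  haveI := isProbabilityMeasure_localGibbsLaw (a₀ := fun _ => (1 : ℝ)) (θ₀ := fun _ => (1 : ℝ))
    (u₀ := fun _ => (0 : V3)) continuous_const continuous_const continuous_const (fun _ => one_pos)
    (fun _ => one_pos) hσhalf N₀ ((hΦ N₀).some)
  simp only [zero_mul, ite_self, Finset.sum_const_zero, finsum_zero, mul_zero, integral_zero,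
    sub_neg_eq_add, zero_add, zero_lt_one, setOf_true, measure_univ] at h
  have h1 : (1 : ℝ≥0∞) ≤ ENNReal.ofReal (1 / 2) := h
  rw [ENNReal.one_le_ofReal] at h1
  norm_num at h1

end RateFloorWithoutEtaPos

end Summit.AtomisticToContinuum.HydrodynamicLimit.Theorems
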